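import Literature.Topology.FourManifolds.HandleAttachingMapsShrink
import Literature.Topology.FourManifolds.HandleAttachingMapOfTube
import HarnessLib

/-!
# The shrinking reparametrisation `ρ_ε` of Kosinski's tube on the boundary sphere: the fibre squeeze

Topic `Literature/Topology/FourManifolds`; a plumbing file below `HandleAttachingMapsShrink.lean`
(the reparametrisation `ρ_ε = α ψ_ε α` of Kosinski's tube `T = {x ∈ D⁴ | x_λ ≠ 0}`, the identity
near the attaching circle `S`, behind `HandleAttachingMap.shrink`) and
`HandleAttachingMapOfTube.lean` (the coordinates angle `x_λ/|x_λ| ∈ S¹`, fibre `x_μ ∈ ℝ²`,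
depth `1 - ‖x‖²` on `T`), serving the passage from Kosinski attachments over `D⁴` to Kirby's
traces (`FramedLink.IsTrace`, `DottedCircleDiagram.Realization`): there the boundary values of an
attaching map must be an oriented tubular neighbourhood `S¹ × ℝ² ↪ S³` of the attaching circle on
the whole unit disc bundle, which is arranged by shrinking.

* §1 **The fibre squeeze `φ_ε : ℝ² → ℝ²`, `φ_ε(v) = m_ε(‖v‖²) v`** (`HandleShrink.fibreSqueeze`;
  `m_ε² a = σ_ε a` the profile of `HandleAttachingMapsShrink.lean`): the identity on `‖v‖² ≤ ε`,
  `‖φ_ε v‖² = σ_ε(‖v‖²) < 2ε`, smooth, a bijection of `ℝ²` onto the open disc `‖w‖² < 2ε` with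
  the explicit inverse `HandleShrink.fibreUnsqueeze`, smooth on that disc.
* §2 **`ρ_ε` on the boundary sphere `T ∩ ∂D⁴` is the fibre squeeze**
  (`HandleShrink.rhoFun_eq_mkTubePt`): for `‖y‖ = 1`, `ρ_ε y` is the point of `T ∩ ∂D⁴` with the
  same angle and fibre `φ_ε(x_μ)` — `α`, `ψ_ε`, `α` are block rescalings with positive
  coefficients, so the fibre of `ρ_ε y` is a positive multiple of `x_μ`, of squared norm
  `1 - |ρ_ε(y)_λ|² = σ_ε(‖x_μ‖²)` (`HandleShrink.lamSq_rhoFun_of_ne`).  Hence the shrunken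
  attaching map `h̄ ∘ ρ_ε` has boundary values `h̄ (θ, φ_ε v)` (`HandleAttachingMap.shrink_mkTubePt`).

Everything here is proved; no named facts are introduced.

## References

* A. A. Kosinski, *Differential Manifolds*, Academic Press (1993), VI §1 (proof of (1.1)), §6,
  (6.1). [Kosinski1993]
-/

open scoped Manifold ContDiff Topology
open Set Function Metric Filter Real

noncomputable section

namespace Literature.Topology.FourManifolds

universe u

namespace HandleShrink

/-! ### §1 The fibre squeeze `φ_ε` of `ℝᵐ` and its inverse -/

section Squeeze

variable {m : ℕ} {ε : ℝ}

/-- **The fibre squeeze `φ_ε(v) = m_ε(‖v‖²) v`** of `ℝᵐ` onto the open disc `‖w‖² < 2ε`.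
[folklore] -/
def fibreSqueeze (ε : ℝ) (v : EuclideanSpace ℝ (Fin m)) : EuclideanSpace ℝ (Fin m) :=
  mFun ε (‖v‖ ^ 2) • v

/-- `‖φ_ε v‖² = σ_ε(‖v‖²)`. [folklore] -/
theorem norm_fibreSqueeze_sq (hε : 0 < ε) (v : EuclideanSpace ℝ (Fin m)) :
    ‖fibreSqueeze ε v‖ ^ 2 = sigma ε (‖v‖ ^ 2) := by
  rw [fibreSqueeze, norm_smul, mul_pow, Real.norm_eq_abs, sq_abs, mFun_sq_mul hε]

/-- `‖φ_ε v‖² < 2ε`. [folklore] -/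
theorem norm_fibreSqueeze_sq_lt (hε : 0 < ε) (v : EuclideanSpace ℝ (Fin m)) :
    ‖fibreSqueeze ε v‖ ^ 2 < 2 * ε := by
  rw [norm_fibreSqueeze_sq hε]; exact sigma_lt hε _

/-- **`φ_ε` is the identity on `‖v‖² ≤ ε`.** [folklore] -/
theorem fibreSqueeze_eq_self_of_le (hε : 0 < ε) {v : EuclideanSpace ℝ (Fin m)} (hv : ‖v‖ ^ 2 ≤ ε) :
    fibreSqueeze ε v = v := by
  rw [fibreSqueeze, mFun_of_le hε hv, one_smul]

/-- `φ_ε 0 = 0`. [folklore] -/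
@[simp] theorem fibreSqueeze_zero (ε : ℝ) : fibreSqueeze ε (0 : EuclideanSpace ℝ (Fin m)) = 0 := by
  rw [fibreSqueeze, smul_zero]

/-- **`φ_ε` is smooth.** [folklore] -/
theorem contDiff_fibreSqueeze (hε : 0 < ε) : ContDiff ℝ ∞ (fibreSqueeze (m := m) ε) :=
  ((contDiff_mFun hε).comp (contDiff_norm_sq ℝ)).smul contDiff_id

/-- The coefficient of the inverse squeeze: `1` on `b ≤ ε/2`, `(σ_ε⁻¹ b / b)^{1/2}` beyond (the two
agree on `(0, ε]`, where `σ_ε⁻¹ = id`). [folklore] -/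
def unsqueezeCoeff (ε b : ℝ) : ℝ := if b ≤ ε / 2 then 1 else Real.sqrt (sigmaInv ε b / b)

/-- `unsqueezeCoeff = 1` on `(-∞, ε]`. [folklore] -/
theorem unsqueezeCoeff_of_le (hε : 0 < ε) {b : ℝ} (hb : b ≤ ε) : unsqueezeCoeff ε b = 1 := by
  unfold unsqueezeCoeff
  split_ifs with h
  · rfl
  · have hb0 : 0 < b := by linarith
    rw [sigmaInv_of_le hε hb, div_self hb0.ne', Real.sqrt_one]

/-- `unsqueezeCoeff b = (σ_ε⁻¹ b / b)^{1/2}` for `ε/2 < b`. [folklore] -/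
theorem unsqueezeCoeff_of_lt {b : ℝ} (hb : ε / 2 < b) :
    unsqueezeCoeff ε b = Real.sqrt (sigmaInv ε b / b) := by
  rw [unsqueezeCoeff, if_neg (not_le.2 hb)]

/-- `0 < σ_ε⁻¹ b` for `0 < b < 2ε` (copy of the tube-free part of `HandleShrink.sigmaInv_pos`).
[folklore] -/
theorem sigmaInv_pos' (hε : 0 < ε) {b : ℝ} (hb0 : 0 < b) (hb : b < 2 * ε) : 0 < sigmaInv ε b := by
  by_contra h
  have := (strictMono_sigma hε).monotone (not_lt.1 h)
  rw [sigma_sigmaInv hε hb0.le hb, sigma_zero hε] at this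
  exact absurd this (not_le.2 hb0)

/-- **`unsqueezeCoeff(b)² b = σ_ε⁻¹ b`** for `0 ≤ b < 2ε`. [folklore] -/
theorem unsqueezeCoeff_sq_mul (hε : 0 < ε) {b : ℝ} (hb0 : 0 ≤ b) (hb : b < 2 * ε) :
    unsqueezeCoeff ε b ^ 2 * b = sigmaInv ε b := by
  rcases le_or_gt b (ε / 2) with h | h
  · rw [unsqueezeCoeff, if_pos h, one_pow, one_mul, sigmaInv_of_le hε (by linarith)]
  · have hb0' : 0 < b := by linarith
    rw [unsqueezeCoeff_of_lt h, Real.sq_sqrt (div_nonneg (sigmaInv_pos' hε hb0' hb).le hb0),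
      div_mul_cancel₀ _ hb0'.ne']

/-- `0 < unsqueezeCoeff b` for `b < 2ε`. [folklore] -/
theorem unsqueezeCoeff_pos (hε : 0 < ε) {b : ℝ} (hb : b < 2 * ε) : 0 < unsqueezeCoeff ε b := by
  rcases le_or_gt b (ε / 2) with h | h
  · rw [unsqueezeCoeff, if_pos h]; exact one_pos
  · have hb0' : 0 < b := by linarith
    rw [unsqueezeCoeff_of_lt h]
    exact Real.sqrt_pos.2 (div_pos (sigmaInv_pos' hε hb0' hb) hb0')

/-- `unsqueezeCoeff` is smooth at every `b < 2ε`. [folklore] -/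
theorem contDiffAt_unsqueezeCoeff (hε : 0 < ε) {b : ℝ} (hb : b < 2 * ε) :
    ContDiffAt ℝ ∞ (unsqueezeCoeff ε) b := by
  rcases lt_or_ge b ε with h | h
  · have : unsqueezeCoeff ε =ᶠ[𝓝 b] fun _ => 1 := by
      filter_upwards [Iio_mem_nhds h] with b' hb'
      exact unsqueezeCoeff_of_le hε hb'.le
    exact contDiffAt_const.congr_of_eventuallyEq this
  · have h2 : ε / 2 < b := by linarith
    have hb0 : 0 < b := by linarith
    have : unsqueezeCoeff ε =ᶠ[𝓝 b] fun b' => Real.sqrt (sigmaInv ε b' / b') := by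
      filter_upwards [Ioi_mem_nhds h2] with b' hb'
      exact unsqueezeCoeff_of_lt hb'
    refine ContDiffAt.congr_of_eventuallyEq ?_ this
    have hinv : ContDiffAt ℝ ∞ (sigmaInv ε) b := by
      have := contDiffAt_sigmaInv hε (sigmaInv ε b)
      rwa [sigma_sigmaInv hε hb0.le hb] at this
    exact (hinv.div contDiffAt_id hb0.ne').sqrt (div_pos (sigmaInv_pos' hε hb0 hb) hb0).ne'

/-- **The inverse squeeze `φ_ε⁻¹(w) = unsqueezeCoeff(‖w‖²) w`** (meaningful on `‖w‖² < 2ε`).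
[folklore] -/
def fibreUnsqueeze (ε : ℝ) (w : EuclideanSpace ℝ (Fin m)) : EuclideanSpace ℝ (Fin m) :=
  unsqueezeCoeff ε (‖w‖ ^ 2) • w

/-- Two nonnegative multiples of a vector with the same norm are equal. [folklore] -/
theorem smul_eq_smul_of_norm_eq {E : Type*} [NormedAddCommGroup E] [NormedSpace ℝ E] {s t : ℝ}
    (hs : 0 ≤ s) (ht : 0 ≤ t) {v : E} (h : ‖s • v‖ = ‖t • v‖) : s • v = t • v := by
  by_cases hv : v = 0
  · rw [hv, smul_zero, smul_zero]
  · rw [norm_smul, norm_smul, Real.norm_of_nonneg hs, Real.norm_of_nonneg ht] at h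
    rw [mul_right_cancel₀ (norm_ne_zero_iff.2 hv) h]

/-- **`φ_ε⁻¹ (φ_ε v) = v`.** [folklore] -/
theorem fibreUnsqueeze_fibreSqueeze (hε : 0 < ε) (v : EuclideanSpace ℝ (Fin m)) :
    fibreUnsqueeze ε (fibreSqueeze ε v) = v := by
  have hb := norm_fibreSqueeze_sq_lt hε v
  rw [fibreUnsqueeze, fibreSqueeze, smul_smul]
  conv_rhs => rw [← one_smul ℝ v]
  apply smul_eq_smul_of_norm_eq (mul_nonneg (unsqueezeCoeff_pos hε (by rwa [← fibreSqueeze])).le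
    (mFun_pos hε _).le) zero_le_one
  rw [one_smul, ← smul_smul]
  have h1 : ‖unsqueezeCoeff ε (‖mFun ε (‖v‖ ^ 2) • v‖ ^ 2) • mFun ε (‖v‖ ^ 2) • v‖ ^ 2 = ‖v‖ ^ 2 := by
    rw [norm_smul, mul_pow, Real.norm_eq_abs, sq_abs]
    have h2 : ‖mFun ε (‖v‖ ^ 2) • v‖ ^ 2 = sigma ε (‖v‖ ^ 2) := norm_fibreSqueeze_sq hε v
    rw [h2, unsqueezeCoeff_sq_mul hε (sigma_nonneg hε (sq_nonneg _)) (sigma_lt hε _),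
      sigmaInv_sigma hε]
  nlinarith [norm_nonneg (unsqueezeCoeff ε (‖mFun ε (‖v‖ ^ 2) • v‖ ^ 2) • mFun ε (‖v‖ ^ 2) • v),
    norm_nonneg v]

/-- **`φ_ε (φ_ε⁻¹ w) = w`** for `‖w‖² < 2ε`. [folklore] -/
theorem fibreSqueeze_fibreUnsqueeze (hε : 0 < ε) {w : EuclideanSpace ℝ (Fin m)} (hw : ‖w‖ ^ 2 < 2 * ε) :
    fibreSqueeze ε (fibreUnsqueeze ε w) = w := by
  rw [fibreUnsqueeze, fibreSqueeze, smul_smul]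
  conv_rhs => rw [← one_smul ℝ w]
  apply smul_eq_smul_of_norm_eq (mul_nonneg (mFun_pos hε _).le (unsqueezeCoeff_pos hε hw).le)
    zero_le_one
  rw [one_smul, ← smul_smul]
  have h1 : ‖mFun ε (‖unsqueezeCoeff ε (‖w‖ ^ 2) • w‖ ^ 2) • unsqueezeCoeff ε (‖w‖ ^ 2) • w‖ ^ 2 =
      ‖w‖ ^ 2 := by
    rw [norm_smul, mul_pow, Real.norm_eq_abs, sq_abs]
    have h2 : ‖unsqueezeCoeff ε (‖w‖ ^ 2) • w‖ ^ 2 = sigmaInv ε (‖w‖ ^ 2) := by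
      rw [norm_smul, mul_pow, Real.norm_eq_abs, sq_abs, unsqueezeCoeff_sq_mul hε (sq_nonneg _) hw]
    rw [h2, mFun_sq_mul hε, sigma_sigmaInv hε (sq_nonneg _) hw]
  nlinarith [norm_nonneg (mFun ε (‖unsqueezeCoeff ε (‖w‖ ^ 2) • w‖ ^ 2) • unsqueezeCoeff ε (‖w‖ ^ 2) • w),
    norm_nonneg w]

/-- **`φ_ε⁻¹` is smooth on the disc `‖w‖² < 2ε`.** [folklore] -/
theorem contDiffAt_fibreUnsqueeze (hε : 0 < ε) {w : EuclideanSpace ℝ (Fin m)} (hw : ‖w‖ ^ 2 < 2 * ε) :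
    ContDiffAt ℝ ∞ (fibreUnsqueeze ε) w :=
  ((contDiffAt_unsqueezeCoeff hε hw).comp w (contDiff_norm_sq ℝ).contDiffAt).smul contDiffAt_id

/-- `φ_ε` is injective. [folklore] -/
theorem injective_fibreSqueeze (hε : 0 < ε) : Injective (fibreSqueeze (m := m) ε) := fun v w h => by
  have := congrArg (fibreUnsqueeze ε) h
  rwa [fibreUnsqueeze_fibreSqueeze hε, fibreUnsqueeze_fibreSqueeze hε] at this

/-- **The range of `φ_ε` is the open disc `‖w‖² < 2ε`.** [folklore] -/
theorem range_fibreSqueeze (hε : 0 < ε) :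
    range (fibreSqueeze (m := m) ε) = {w | ‖w‖ ^ 2 < 2 * ε} :=
  Subset.antisymm (range_subset_iff.2 fun v => norm_fibreSqueeze_sq_lt hε v)
    fun _ hw => ⟨_, fibreSqueeze_fibreUnsqueeze hε hw⟩

end Squeeze

/-! ### §2 `ρ_ε` on the boundary sphere of `T ⊆ D⁴` -/

section Boundary

set_option quotPrecheck false in
/-- Local notation: Kosinski's tube `T ⊆ D⁴`, as a type. -/
local notation "𝕋" => ↥(handleTube 3 2)

variable {ε : ℝ} (hε : 0 < ε) (hε2 : 2 * ε ≤ 1)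

/-- The `λ`-part of a block rescaling of `ℝ⁴`. [folklore] -/
theorem lamPart_blockScale (c d : ℝ) (u : EuclideanSpace ℝ (Fin 4)) :
    lamPart (blockScale 2 c d u) = c • lamPart u := by
  ext i
  fin_cases i <;> simp [lamPart, blockScale_apply]

/-- The `μ`-part of a block rescaling of `ℝ⁴`. [folklore] -/
theorem muPart_blockScale (c d : ℝ) (u : EuclideanSpace ℝ (Fin 4)) :
    muPart (blockScale 2 c d u) = d • muPart u := by
  ext i
  fin_cases i <;> simp [muPart, blockScale_apply]

/-- **`ρ_ε y` as a block rescaling of `y` with positive coefficients**, off the attaching circle.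
[folklore] -/
theorem exists_tubeVec_rhoFun_eq_blockScale [Nonempty 𝕋] {y : 𝕋} (hy : lamSq 2 (tubeVec y) ≠ 1) :
    ∃ c d : ℝ, 0 < c ∧ 0 < d ∧ tubeVec (rhoFun 3 2 hε hε2 y) = blockScale 2 c d (tubeVec y) := by
  have ha0 : 0 < lamSq 2 (tubeVec y) := lamSq_tubeVec_pos y
  have ha1 : lamSq 2 (tubeVec y) < 1 := lt_of_le_of_ne (lamSq_le_one (norm_tubeVec_le_one y)) hy
  set a := lamSq 2 (tubeVec y) with ha
  -- `α y`
  set u₁ := handleInversion 2 (tubeVec y) with hu₁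
  have hL₁ : lamSq 2 u₁ = 1 - a := lamSq_handleInversion ha0 ha1.le
  -- `ψ (α y)`
  set u₂ := psi ε 2 u₁ with hu₂
  have hL₂ : lamSq 2 u₂ = sigma ε (1 - a) := by rw [hu₂, lamSq_psi hε, hL₁]
  have hb0 : 0 < sigma ε (1 - a) := sigma_pos hε (by linarith)
  have hb1 : sigma ε (1 - a) < 1 := sigma_lt_one hε hε2 _
  have hvec : tubeVec (rhoFun 3 2 hε hε2 y) = handleInversion 2 u₂ := coe_coe_rhoFun_of_ne 3 2 hε hε2 hy
  refine ⟨Real.sqrt (1 - lamSq 2 u₂) / Real.sqrt (lamSq 2 u₂) * mFun ε (lamSq 2 u₁) *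
      (Real.sqrt (1 - a) / Real.sqrt a),
    Real.sqrt (lamSq 2 u₂) / Real.sqrt (1 - lamSq 2 u₂) * cFun ε (lamSq 2 u₁) *
      (Real.sqrt a / Real.sqrt (1 - a)), ?_, ?_, ?_⟩
  · refine mul_pos (mul_pos (div_pos (Real.sqrt_pos.2 (by rw [hL₂]; linarith))
      (Real.sqrt_pos.2 (by rw [hL₂]; exact hb0))) (mFun_pos hε _)) (div_pos (Real.sqrt_pos.2 (by linarith))
      (Real.sqrt_pos.2 ha0))
  · refine mul_pos (mul_pos (div_pos (Real.sqrt_pos.2 (by rw [hL₂]; exact hb0))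
      (Real.sqrt_pos.2 (by rw [hL₂]; linarith))) (cFun_pos hε hε2 (by rw [hL₁]; linarith)))
      (div_pos (Real.sqrt_pos.2 ha0) (Real.sqrt_pos.2 (by linarith)))
  · rw [hvec, handleInversion_eq_blockScale, hu₂, psi, hu₁, handleInversion_eq_blockScale, ← ha,
      blockScale_blockScale, blockScale_blockScale]

/-- On the boundary sphere, `‖x_μ‖² = 1 - |x_λ|²`. [folklore] -/
theorem norm_tubeFibre_sq_of_norm_eq_one {y : 𝕋} (hy : ‖tubeVec y‖ = 1) :
    ‖tubeFibre y‖ ^ 2 = 1 - lamSq 2 (tubeVec y) := by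
  have h := lamSq_add_muSq 2 (tubeVec y)
  rw [hy, one_pow] at h
  rw [tubeFibre, norm_muPart_sq]; linarith

include hε hε2 in
/-- **The fibre of `ρ_ε y` is `φ_ε` of the fibre of `y`**, for `y` on the boundary sphere.
[folklore] -/
theorem tubeFibre_rhoFun [Nonempty 𝕋] {y : 𝕋} (hy : ‖tubeVec y‖ = 1) :
    tubeFibre (rhoFun 3 2 hε hε2 y) = fibreSqueeze ε (tubeFibre y) := by
  by_cases h1 : lamSq 2 (tubeVec y) = 1
  · have h0 : tubeFibre y = 0 := by
      have := norm_tubeFibre_sq_of_norm_eq_one hy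
      rw [h1, sub_self] at this
      exact norm_eq_zero.1 (pow_eq_zero_iff two_ne_zero |>.1 this)
    rw [rhoFun_of_eq_one 3 2 hε hε2 h1, h0, fibreSqueeze_zero]
  · obtain ⟨c, d, hc, hd, hvec⟩ := exists_tubeVec_rhoFun_eq_blockScale hε hε2 h1
    have hfib : tubeFibre (rhoFun 3 2 hε hε2 y) = d • tubeFibre y := by
      rw [tubeFibre, hvec, muPart_blockScale]; rfl
    rw [hfib, fibreSqueeze]
    apply smul_eq_smul_of_norm_eq hd.le (mFun_pos hε _).le
    -- both have squared norm `σ_ε(‖x_μ‖²)`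
    have hρ1 : ‖tubeVec (rhoFun 3 2 hε hε2 y)‖ = 1 := (norm_rho_eq_one_iff 3 2 hε hε2 y).2 hy
    have hn1 : ‖d • tubeFibre y‖ ^ 2 = sigma ε (‖tubeFibre y‖ ^ 2) := by
      rw [← hfib, norm_tubeFibre_sq_of_norm_eq_one hρ1]
      have hl : lamSq 2 (tubeVec (rhoFun 3 2 hε hε2 y)) = 1 - sigma ε (1 - lamSq 2 (tubeVec y)) :=
        lamSq_rhoFun_of_ne 3 2 hε hε2 h1
      rw [hl, norm_tubeFibre_sq_of_norm_eq_one hy]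
      ring
    have hn2 : ‖mFun ε (‖tubeFibre y‖ ^ 2) • tubeFibre y‖ ^ 2 = sigma ε (‖tubeFibre y‖ ^ 2) :=
      norm_fibreSqueeze_sq hε _
    have := hn1.trans hn2.symm
    exact (sq_eq_sq₀ (norm_nonneg _) (norm_nonneg _)).1 this

include hε hε2 in
/-- **The angle of `ρ_ε y` is the angle of `y`** (the `λ`-part is rescaled by a positive factor).
[folklore] -/
theorem tubeAngle_rhoFun [Nonempty 𝕋] (y : 𝕋) : tubeAngle (rhoFun 3 2 hε hε2 y) = tubeAngle y := by
  by_cases h1 : lamSq 2 (tubeVec y) = 1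
  · rw [rhoFun_of_eq_one 3 2 hε hε2 h1]
  · obtain ⟨c, d, hc, hd, hvec⟩ := exists_tubeVec_rhoFun_eq_blockScale hε hε2 h1
    apply Subtype.ext
    have hlam : lamPart (tubeVec (rhoFun 3 2 hε hε2 y)) = c • lamPart (tubeVec y) := by
      rw [hvec, lamPart_blockScale]
    have hpos := norm_lamPart_tubeVec_pos y
    rw [coe_tubeAngle, coe_tubeAngle, hlam, norm_smul, Real.norm_of_nonneg hc.le, smul_smul,
      mul_inv]
    congr 1
    field_simp

include hε hε2 in
/-- **`ρ_ε` preserves the depth `0`** (the boundary sphere). [folklore] -/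
theorem tubeDepth_rhoFun_eq_zero [Nonempty 𝕋] {y : 𝕋} (hy : tubeDepth y = 0) :
    tubeDepth (rhoFun 3 2 hε hε2 y) = 0 := by
  rw [tubeDepth_eq_zero_iff] at hy ⊢
  exact (norm_rho_eq_one_iff 3 2 hε hε2 y).2 hy

/-- A fibre vector of squared norm `< 1` leaves room at depth `0`. [folklore] -/
theorem depth_zero_pos {v : EuclideanSpace ℝ (Fin 2)} (hv : ‖v‖ ^ 2 < 1) : 0 < 1 - 0 - ‖v‖ ^ 2 := by
  linarith

include hε hε2 in
/-- **`ρ_ε` on the boundary sphere is the fibre squeeze**: for `‖v‖ < 1`,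
`ρ_ε (θ, v, 0) = (θ, φ_ε v, 0)` in the coordinates (angle, fibre, depth). [folklore] -/
theorem rhoFun_mkTubePt [Nonempty 𝕋] (θ : Metric.sphere (0 : EuclideanSpace ℝ (Fin 2)) 1)
    {v : EuclideanSpace ℝ (Fin 2)} (hv : ‖v‖ ^ 2 < 1) :
    rhoFun 3 2 hε hε2 (mkTubePt θ v 0 le_rfl (depth_zero_pos hv)) =
      mkTubePt θ (fibreSqueeze ε v) 0 le_rfl
        (depth_zero_pos ((norm_fibreSqueeze_sq_lt hε v).trans_le hε2)) := by
  set y := mkTubePt θ v 0 le_rfl (depth_zero_pos hv) with hydef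
  have hy0 : tubeDepth y = 0 := tubeDepth_mkTubePt _ _ _ _ _
  have hρ0 : tubeDepth (rhoFun 3 2 hε hε2 y) = 0 := tubeDepth_rhoFun_eq_zero hε hε2 hy0
  have hy1 : ‖tubeVec y‖ = 1 := (tubeDepth_eq_zero_iff y).1 hy0
  have hpos : 0 < 1 - tubeDepth (rhoFun 3 2 hε hε2 y) - ‖tubeFibre (rhoFun 3 2 hε hε2 y)‖ ^ 2 := by
    have := tubeDepth_add_norm_tubeFibre_sq_lt_one (rhoFun 3 2 hε hε2 y); linarith
  rw [← mkTubePt_tube (rhoFun 3 2 hε hε2 y) (tubeDepth_nonneg _) hpos]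
  have hA : tubeAngle (rhoFun 3 2 hε hε2 y) = θ := by
    rw [tubeAngle_rhoFun hε hε2, hydef, tubeAngle_mkTubePt]
  have hF : tubeFibre (rhoFun 3 2 hε hε2 y) = fibreSqueeze ε v := by
    rw [tubeFibre_rhoFun hε hε2 hy1, hydef, tubeFibre_mkTubePt]
  apply Subtype.ext; apply Subtype.ext
  show mkVec _ _ _ = mkVec _ _ _
  rw [hA, hF, hρ0]

end Boundary

end HandleShrink

/-! ### §3 The boundary values of the shrunken attaching map -/

namespace HandleAttachingMap

variable {M : Type u} [TopologicalSpace M] [ChartedSpace (EuclideanHalfSpace (3 + 1)) M] {ε : ℝ}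
  [Nonempty ↥(handleTube 3 2)] (h : HandleAttachingMap 3 2 M) (hε : 0 < ε) (hε2 : 2 * ε ≤ 1)

/-- **The shrunken attaching map on the boundary sphere**: `(h̄ ∘ ρ_ε)(θ, v, 0) = h̄ (θ, φ_ε v, 0)`
for `‖v‖ < 1`. [cite: Kosinski1993, VI §6 with VI §1 (proof of (1.1))] -/
theorem shrink_mkTubePt (θ : Metric.sphere (0 : EuclideanSpace ℝ (Fin 2)) 1)
    {v : EuclideanSpace ℝ (Fin 2)} (hv : ‖v‖ ^ 2 < 1) :
    (h.shrink hε hε2).toFun (mkTubePt θ v 0 le_rfl (HandleShrink.depth_zero_pos hv)) =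
      h.toFun (mkTubePt θ (HandleShrink.fibreSqueeze ε v) 0 le_rfl
        (HandleShrink.depth_zero_pos ((HandleShrink.norm_fibreSqueeze_sq_lt hε v).trans_le hε2))) := by
  rw [shrink_apply, HandleShrink.rhoFun_mkTubePt hε hε2 θ hv]

end HandleAttachingMap

end Literature.Topology.FourManifolds
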